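/-
Copyright (c) 2026 the pub-hodgecm-mathlib formalisation cell (harness21).  Prover seat hodgecm-mathlib-K2E4-p11 (g4), Track B ∕ K2-LIT, h413 =
`stmt-HodgeConjecture-24833`, line `K2_E1_TraceFormulaBeta`, campaign «EIS-RANK-ONE», rung R6d₃, deal «(R3u)₃» of K2E1-plan (g4) 2026-09-04T07:03:26Z, FILE U3a: the
z-UNIFORM envelope masses and shell sum at the CM pair on a compact `Kc ⊂ {2 < Re z}` (RULING «CONSTANTS-FIRST» 07:06:19Z (c): two extreme exponents, `σ′ := (2+σ₁)∕2`, `θ := 1+σ₁`).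
-/
import Summits.HodgeConjecture.HodgeConjecture.Theorems.K2E1CentreLineShellSumU3          -- ★ p858133 (D2-f) FILE 2 (this seat): the shell sum; brings ★ p858088 FILE 1 (masses) and ★ p857765
import Summits.HodgeConjecture.HodgeConjecture.Theorems.K2E1BorelEisensteinRegularCMThree   -- ★ `rpow_le_rpow_add_rpow` (`H^σ ≤ H^{σ₁} + H^{σ₂}`)
import HarnessLib

/-!
# h413 ∕ Track B «K2-LIT», «EIS-RANK-ONE» (R3u)₃ FILE U3a — `K2E1CentreLineMassUniformCMThree`: ONE envelope mass `N`, ONE shell constant `B_F`, ONE exponent `θ`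
# for the whole family of flat sections `f_z`, `z ∈ Kc` compact `⊂ {2 < Re z}`, of `U(2,1)` over a CM field

Cell `pub/hodgecm-mathlib`, crux H413 = `stmt-HodgeConjecture-24833`, route `HCCMUnconditional`; dealer K2E1-plan (g4), deal «(R3u)₃» 2026-09-04T07:03:26Z, REPORT-FIRST 07:05:55Z,
RULING «CONSTANTS-FIRST» 07:06:19Z.  THEOREMS ONLY (no `def`, no `instance`, no `notation`, no named-fact hypothesis, no `sorry`); lane
`--kind proof --supports stmt-HodgeConjecture-24833 --as helper` (count-neutral).
THE POINT.  The z-uniform cusp bound (FILE U3b `K2E1EisensteinMinusConstantTermBoundedCMThreeUniform`) feeds ★ edition A∕B's binders `hN0 h𝓔i h𝓔N hBF hshell hθ` with data that do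
NOT depend on `z ∈ Kc`: with `σ₁ = min_{Kc} Re`, `σ₂ = max_{Kc} Re` (compactness) and `H^{Re z} ≤ H^{σ₁} + H^{σ₂}` (★ `rpow_le_rpow_add_rpow`), the envelope `C_φ·H^{Re z}` of `f_z` has
centre-line mass `≤ N(X) := C_φ·(∫ H(ι(w₀)u(X,θt))^{σ₁} + ∫ H(ι(w₀)u(X,θt))^{σ₂})` (★ p858088: finite for every `X`; `k`-free via `H(x k) = H(x)` on `K_U` ★), and `N` has the shell sum
`Σ_{x₀} N(l₁(x₀ − Y)) ≤ B_F·(‖l₂‖⁻¹)^θ` with `θ := 2σ′ − 1 = 1 + σ₁` (★ p858133 twice at `σ′ := (2 + σ₁)∕2 ∈ (2, σ₁]`), whence `hθ : θ + 1 = 2 + σ₁ ≤ Re z + m∕[L⁺:ℚ]` on `Kc` from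
`m > [L:ℚ] = 2[L⁺:ℚ]`.
* **`exists_uniform_centreLine_mass_and_shell_cm_three`** — `∃ N B_F θ, (∀ X, 0 ≤ N X) ∧ 0 ≤ B_F ∧ (∀ z ∈ Kc, θ + 1 ≤ Re z + m∕[L⁺:ℚ]) ∧ (∀ z ∈ Kc, ∀ k ∈ K_U, ∀ X, Integrable
  (t ↦ C_φ·H(ι(w₀)u(X,θt)k)^{Re z}) ∧ ∫ ≤ N X) ∧ (∀ l₁ l₂ Y, ‖l₂‖ ≤ 1 → ‖l₁‖ = ‖l₂‖ → Summable (x₀ ↦ N(l₁(x₀ − Y))) ∧ Σ' ≤ B_F·(‖l₂‖⁻¹)^θ)` — the binders `hN0`, `h𝓔i`, `h𝓔N`,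
  `hBF`, `hshell`, `hθ` of ★ p858125 for EVERY `z ∈ Kc` at once, with `𝓔 := C_φ·H^{Re z}`.
HONEST LABEL.  Count-neutral helper; proves no printed statement; HC_CM is proved only modulo the 7 printed citations (2 remaining named inputs: hLiu418 =
`stmt-HodgeConjecture-24832`, h413 = `stmt-HodgeConjecture-24833`) until rung 0 closes.

## References
* [MoeglinWaldspurger1995] C. Mœglin, J.-L. Waldspurger, *Spectral decomposition and Eisenstein series* (1995), I.2.13, II.1.5, II.1.7, IV.2.
* [Garrett2018] P. Garrett, *Modern Analysis of Automorphic Forms by Example* 1 (2018), §2.8–§2.11.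
* [Arthur1980TraceFormulaII] J. Arthur, *A trace formula for reductive groups II*, Compositio Math. 40 (1980), §4.
-/

set_option autoImplicit false
set_option linter.dupNamespace false  -- the mandated namespace repeats the summit's segment (`HodgeConjecture.HodgeConjecture`)

noncomputable section

open MeasureTheory Measure Filter Topology NumberField IsDedekindDomain MulAction Module Set
open Literature.NumberTheory.Automorphic Literature.NumberTheory.Automorphic.UnitaryGroup
open Summit.HodgeConjecture.HodgeConjecture.Cruxes.H413.K2E1CentreLineMassU3
open Summit.HodgeConjecture.HodgeConjecture.Cruxes.H413.K2E1CentreLineShellSumU3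
open scoped ENNReal NNReal

namespace Summit.HodgeConjecture.HodgeConjecture.Cruxes.H413.K2E1CentreLineMassUniformCMThree

variable (L : Type) [Field L] [NumberField L] [IsCMField L]
  [MeasurableSpace (AdeleRing (𝓞 ↥(maximalRealSubfield L)) ↥(maximalRealSubfield L))] [BorelSpace (AdeleRing (𝓞 ↥(maximalRealSubfield L)) ↥(maximalRealSubfield L))]

/-- **ONE ENVELOPE MASS, ONE SHELL CONSTANT, ONE EXPONENT FOR THE FAMILY `f_z`, `z ∈ Kc`** (see the module docstring): for a CM field `L`, a compact `Kc ⊂ {2 < Re z}`, `C_φ ≥ 0` and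
`m > [L:ℚ]` there are `N ≥ 0`, `B_F ≥ 0`, `θ` with `θ + 1 ≤ Re z + m∕[L⁺:ℚ]` on `Kc`, such that `C_φ·H(ι(w₀)·u(X,θt)·k)^{Re z}` is integrable along every centre line with integral `≤ N X`
(`k ∈ K_U`, every `z ∈ Kc`, every `X`) and `Σ'_{x₀ ∈ L} N(l₁·((x₀)_𝔸 − Y)) ≤ B_F·(‖l₂‖⁻¹)^θ` (summable) whenever `‖l₂‖ ≤ 1`, `‖l₁‖ = ‖l₂‖` — the binders `hN0 h𝓔i h𝓔N hBF hshell hθ` of ★ p858125,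
uniformly in `z`. [cite: MoeglinWaldspurger1995, II.1.7, IV.2] [cite: Garrett2018, §2.8–§2.9] [cite: Arthur1980TraceFormulaII, §4] -/
theorem exists_uniform_centreLine_mass_and_shell_cm_three {δ : L} (hc : IsCMField.complexConj L * IsCMField.complexConj L = 1) (hcδ : IsCMField.complexConj L δ = -δ) (hδ : δ ≠ 0)
    (μF : Measure (AdeleRing (𝓞 ↥(maximalRealSubfield L)) ↥(maximalRealSubfield L))) [μF.IsAddHaarMeasure]
    {Kc : Set ℂ} (hKc : IsCompact Kc) (hKc2 : ∀ z ∈ Kc, 2 < z.re) {Cφ : ℝ} (hCφ : 0 ≤ Cφ) {m : ℕ} (hm : (finrank ℚ L : ℝ) < m) :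
    ∃ (N : AdeleRing (𝓞 L) L → ℝ) (BF θ : ℝ), (∀ X, 0 ≤ N X) ∧ 0 ≤ BF ∧ (∀ z ∈ Kc, θ + 1 ≤ z.re + (m : ℝ) / (finrank ℚ ↥(maximalRealSubfield L) : ℝ)) ∧
      (∀ z ∈ Kc, ∀ k ∈ ((standardMaximalCompactGL 3 L).comap (adelicVal ↥(maximalRealSubfield L) L (IsCMField.complexConj L) 3 ((StdForm.antidiagonal 3).over L)) :
          Subgroup (quasiSplit (↥(maximalRealSubfield L)) L (IsCMField.complexConj L) 3).Adelic), ∀ X : AdeleRing (𝓞 L) L,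
        Integrable (fun t : AdeleRing (𝓞 ↥(maximalRealSubfield L)) ↥(maximalRealSubfield L) => Cφ * ((borelHeight (((quasiSplit (↥(maximalRealSubfield L)) L (IsCMField.complexConj L) 3).toAdelic
            (weylLongU ((IsCMField.complexConj L : L ≃ₐ[↥(maximalRealSubfield L)] L) : L →+* L) (rfl : ((StdForm.antidiagonal 3).over L) = ((StdForm.antidiagonal 3).over L)))) *
          ((heisChart hc (X, traceZeroLine ↥(maximalRealSubfield L) L (IsCMField.complexConj L) hcδ hδ t) : ↥(adelicUnipotent ↥(maximalRealSubfield L) L (IsCMField.complexConj L) 3)) :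
            (quasiSplit (↥(maximalRealSubfield L)) L (IsCMField.complexConj L) 3).Adelic) * k) : ℝ)) ^ z.re) μF ∧
        ∫ t, Cφ * ((borelHeight (((quasiSplit (↥(maximalRealSubfield L)) L (IsCMField.complexConj L) 3).toAdelic
            (weylLongU ((IsCMField.complexConj L : L ≃ₐ[↥(maximalRealSubfield L)] L) : L →+* L) (rfl : ((StdForm.antidiagonal 3).over L) = ((StdForm.antidiagonal 3).over L)))) *
          ((heisChart hc (X, traceZeroLine ↥(maximalRealSubfield L) L (IsCMField.complexConj L) hcδ hδ t) : ↥(adelicUnipotent ↥(maximalRealSubfield L) L (IsCMField.complexConj L) 3)) :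
            (quasiSplit (↥(maximalRealSubfield L)) L (IsCMField.complexConj L) 3).Adelic) * k) : ℝ)) ^ z.re ∂μF ≤ N X) ∧
      (∀ (l₁ : (AdeleRing (𝓞 L) L)ˣ) (l₂ : (AdeleRing (𝓞 ↥(maximalRealSubfield L)) ↥(maximalRealSubfield L))ˣ) (Y : AdeleRing (𝓞 L) L),
        ((IdeleClassGroup.ideleNorm ↥(maximalRealSubfield L) l₂ : ℝ≥0) : ℝ) ≤ 1 → ((IdeleClassGroup.ideleNorm L l₁ : ℝ≥0) : ℝ) = ((IdeleClassGroup.ideleNorm ↥(maximalRealSubfield L) l₂ : ℝ≥0) : ℝ) →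
        (Summable fun x₀ : L => N ((l₁ : AdeleRing (𝓞 L) L) * (algebraMap L (AdeleRing (𝓞 L) L) x₀ - Y))) ∧
        ∑' x₀ : L, N ((l₁ : AdeleRing (𝓞 L) L) * (algebraMap L (AdeleRing (𝓞 L) L) x₀ - Y)) ≤ BF * (((IdeleClassGroup.ideleNorm ↥(maximalRealSubfield L) l₂ : ℝ≥0) : ℝ)⁻¹) ^ θ) := by
  classical
  -- the CM pair
  haveI : Algebra.IsQuadraticExtension ↥(maximalRealSubfield L) L := IsCMField.isQuadraticExtension L
  have hc1 : IsCMField.complexConj L ≠ 1 := IsCMField.complexConj_ne_one L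
  have hIw := exists_mem_borelAdelic_mul_mem_standardMaximalCompactGL_cm_three L
  -- `2 ≤ m ∕ [L⁺:ℚ]` from `[L:ℚ] = 2·[L⁺:ℚ] < m`
  have hd : 0 < (finrank ℚ ↥(maximalRealSubfield L) : ℝ) := Nat.cast_pos.2 finrank_pos
  have hmd : (2 : ℝ) ≤ (m : ℝ) / (finrank ℚ ↥(maximalRealSubfield L) : ℝ) := by
    have h2 := Module.finrank_mul_finrank ℚ ↥(maximalRealSubfield L) L
    rw [Algebra.IsQuadraticExtension.finrank_eq_two ↥(maximalRealSubfield L) L] at h2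
    rw [le_div_iff₀ hd]
    have h2' : ((finrank ℚ ↥(maximalRealSubfield L) : ℕ) : ℝ) * 2 = (finrank ℚ L : ℝ) := by exact_mod_cast h2
    linarith
  set W : (quasiSplit (↥(maximalRealSubfield L)) L (IsCMField.complexConj L) 3).Adelic := ((quasiSplit (↥(maximalRealSubfield L)) L (IsCMField.complexConj L) 3).toAdelic
    (weylLongU ((IsCMField.complexConj L : L ≃ₐ[↥(maximalRealSubfield L)] L) : L →+* L) (rfl : ((StdForm.antidiagonal 3).over L) = ((StdForm.antidiagonal 3).over L)))) with hW
  rcases Kc.eq_empty_or_nonempty with hKe | hKne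
  · refine ⟨fun _ => 0, 0, 0, fun _ => le_rfl, le_rfl, fun z hz => ?_, fun z hz => ?_, fun l₁ l₂ Y _ _ => ⟨summable_zero, ?_⟩⟩
    · simp [hKe] at hz
    · simp [hKe] at hz
    · rw [tsum_zero, zero_mul]
  -- the two extreme exponents
  obtain ⟨z₁, hz₁, hmin⟩ := hKc.exists_isMinOn hKne Complex.continuous_re.continuousOn
  obtain ⟨z₂, hz₂, hmax⟩ := hKc.exists_isMaxOn hKne Complex.continuous_re.continuousOn
  have hσ₁ : 2 < z₁.re := hKc2 z₁ hz₁
  have hσ₂ : 2 < z₂.re := hKc2 z₂ hz₂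
  have h12 : z₁.re ≤ z₂.re := hmin hz₂
  have hσ'2 : 2 < (2 + z₁.re) / 2 := by linarith
  have hσ'1 : (2 + z₁.re) / 2 ≤ z₁.re := by linarith
  have hσ'2' : (2 + z₁.re) / 2 ≤ z₂.re := by linarith
  obtain ⟨B₁, hB₁, hS₁⟩ := exists_forall_tsum_lineMass_dilate_sub_le_three hc hc1 hcδ hδ hIw μF (σ := z₁.re) (σ' := (2 + z₁.re) / 2) hσ'2 hσ'1
  obtain ⟨B₂, hB₂, hS₂⟩ := exists_forall_tsum_lineMass_dilate_sub_le_three hc hc1 hcδ hδ hIw μF (σ := z₂.re) (σ' := (2 + z₁.re) / 2) hσ'2 hσ'2'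
  refine ⟨fun X => Cφ * (∫ t, ((borelHeight (W * ((heisChart hc (X, traceZeroLine ↥(maximalRealSubfield L) L (IsCMField.complexConj L) hcδ hδ t) :
        ↥(adelicUnipotent ↥(maximalRealSubfield L) L (IsCMField.complexConj L) 3)) : (quasiSplit (↥(maximalRealSubfield L)) L (IsCMField.complexConj L) 3).Adelic)) : ℝ)) ^ z₁.re ∂μF +
      ∫ t, ((borelHeight (W * ((heisChart hc (X, traceZeroLine ↥(maximalRealSubfield L) L (IsCMField.complexConj L) hcδ hδ t) :
        ↥(adelicUnipotent ↥(maximalRealSubfield L) L (IsCMField.complexConj L) 3)) : (quasiSplit (↥(maximalRealSubfield L)) L (IsCMField.complexConj L) 3).Adelic)) : ℝ)) ^ z₂.re ∂μF),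
    Cφ * (B₁ + B₂), 2 * ((2 + z₁.re) / 2) - 1, fun X => ?_, mul_nonneg hCφ (add_nonneg hB₁ hB₂), fun z hz => ?_, fun z hz k hk X => ?_, fun l₁ l₂ Y hl₂ hl => ?_⟩
  · exact mul_nonneg hCφ (add_nonneg (integral_nonneg fun t => Real.rpow_nonneg (NNReal.coe_nonneg _) _) (integral_nonneg fun t => Real.rpow_nonneg (NNReal.coe_nonneg _) _))
  · have h1 : z₁.re ≤ z.re := hmin hz
    linarith
  · -- the envelope `C_φ·H^{Re z}` along the centre line through `k ∈ K_U`: dominated by `C_φ·(H^{σ₁} + H^{σ₂})`, and `H(x k) = H(x)`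
    have h1 : z₁.re ≤ z.re := hmin hz
    have h2 : z.re ≤ z₂.re := hmax hz
    have hz0 : (0 : ℝ) ≤ z.re := by linarith [hKc2 z hz]
    have hHk : ∀ t : AdeleRing (𝓞 ↥(maximalRealSubfield L)) ↥(maximalRealSubfield L), borelHeight (W * ((heisChart hc (X, traceZeroLine ↥(maximalRealSubfield L) L (IsCMField.complexConj L) hcδ hδ t) :
        ↥(adelicUnipotent ↥(maximalRealSubfield L) L (IsCMField.complexConj L) 3)) : (quasiSplit (↥(maximalRealSubfield L)) L (IsCMField.complexConj L) 3).Adelic) * k) =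
        borelHeight (W * ((heisChart hc (X, traceZeroLine ↥(maximalRealSubfield L) L (IsCMField.complexConj L) hcδ hδ t) :
        ↥(adelicUnipotent ↥(maximalRealSubfield L) L (IsCMField.complexConj L) 3)) : (quasiSplit (↥(maximalRealSubfield L)) L (IsCMField.complexConj L) 3).Adelic)) := fun t =>
      borelHeight_mul_of_mem_comap_standardMaximalCompactGL hk _
    have hi₁ := integrable_centreLine_borelHeight_rpow_three hc hc1 hcδ hδ hIw μF hσ₁ X k
    have hi₂ := integrable_centreLine_borelHeight_rpow_three hc hc1 hcδ hδ hIw μF hσ₂ X k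
    have hdom : ∀ t : AdeleRing (𝓞 ↥(maximalRealSubfield L)) ↥(maximalRealSubfield L), ‖Cφ * ((borelHeight (W * ((heisChart hc (X, traceZeroLine ↥(maximalRealSubfield L) L (IsCMField.complexConj L) hcδ hδ t) :
        ↥(adelicUnipotent ↥(maximalRealSubfield L) L (IsCMField.complexConj L) 3)) : (quasiSplit (↥(maximalRealSubfield L)) L (IsCMField.complexConj L) 3).Adelic) * k) : ℝ)) ^ z.re‖ ≤
        Cφ * (((borelHeight (W * ((heisChart hc (X, traceZeroLine ↥(maximalRealSubfield L) L (IsCMField.complexConj L) hcδ hδ t) :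
          ↥(adelicUnipotent ↥(maximalRealSubfield L) L (IsCMField.complexConj L) 3)) : (quasiSplit (↥(maximalRealSubfield L)) L (IsCMField.complexConj L) 3).Adelic) * k) : ℝ)) ^ z₁.re +
          ((borelHeight (W * ((heisChart hc (X, traceZeroLine ↥(maximalRealSubfield L) L (IsCMField.complexConj L) hcδ hδ t) :
          ↥(adelicUnipotent ↥(maximalRealSubfield L) L (IsCMField.complexConj L) 3)) : (quasiSplit (↥(maximalRealSubfield L)) L (IsCMField.complexConj L) 3).Adelic) * k) : ℝ)) ^ z₂.re) := fun t => by
      rw [Real.norm_of_nonneg (mul_nonneg hCφ (Real.rpow_nonneg (NNReal.coe_nonneg _) _))]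
      exact mul_le_mul_of_nonneg_left (K2E1BorelEisensteinRegularCMThree.rpow_le_rpow_add_rpow (by exact_mod_cast borelHeight_pos _) h1 h2) hCφ
    have hmeas : AEStronglyMeasurable (fun t : AdeleRing (𝓞 ↥(maximalRealSubfield L)) ↥(maximalRealSubfield L) => Cφ * ((borelHeight (W * ((heisChart hc (X, traceZeroLine ↥(maximalRealSubfield L) L (IsCMField.complexConj L) hcδ hδ t) :
        ↥(adelicUnipotent ↥(maximalRealSubfield L) L (IsCMField.complexConj L) 3)) : (quasiSplit (↥(maximalRealSubfield L)) L (IsCMField.complexConj L) 3).Adelic) * k) : ℝ)) ^ z.re) μF :=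
      (continuous_const.mul (continuous_centreLine_borelHeight_rpow_three hc hcδ hδ hz0 X k)).aestronglyMeasurable
    have hint : Integrable (fun t : AdeleRing (𝓞 ↥(maximalRealSubfield L)) ↥(maximalRealSubfield L) => Cφ * ((borelHeight (W * ((heisChart hc (X, traceZeroLine ↥(maximalRealSubfield L) L (IsCMField.complexConj L) hcδ hδ t) :
        ↥(adelicUnipotent ↥(maximalRealSubfield L) L (IsCMField.complexConj L) 3)) : (quasiSplit (↥(maximalRealSubfield L)) L (IsCMField.complexConj L) 3).Adelic) * k) : ℝ)) ^ z.re) μF :=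
      ((hi₁.add hi₂).const_mul Cφ).mono' hmeas (Eventually.of_forall hdom)
    refine ⟨hint, ?_⟩
    have hf₁ : (fun t : AdeleRing (𝓞 ↥(maximalRealSubfield L)) ↥(maximalRealSubfield L) => ((borelHeight (W * ((heisChart hc (X, traceZeroLine ↥(maximalRealSubfield L) L (IsCMField.complexConj L) hcδ hδ t) :
        ↥(adelicUnipotent ↥(maximalRealSubfield L) L (IsCMField.complexConj L) 3)) : (quasiSplit (↥(maximalRealSubfield L)) L (IsCMField.complexConj L) 3).Adelic) * k) : ℝ)) ^ z₁.re) =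
        fun t => ((borelHeight (W * ((heisChart hc (X, traceZeroLine ↥(maximalRealSubfield L) L (IsCMField.complexConj L) hcδ hδ t) :
        ↥(adelicUnipotent ↥(maximalRealSubfield L) L (IsCMField.complexConj L) 3)) : (quasiSplit (↥(maximalRealSubfield L)) L (IsCMField.complexConj L) 3).Adelic)) : ℝ)) ^ z₁.re :=
      funext fun t => by rw [hHk t]
    have hf₂ : (fun t : AdeleRing (𝓞 ↥(maximalRealSubfield L)) ↥(maximalRealSubfield L) => ((borelHeight (W * ((heisChart hc (X, traceZeroLine ↥(maximalRealSubfield L) L (IsCMField.complexConj L) hcδ hδ t) :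
        ↥(adelicUnipotent ↥(maximalRealSubfield L) L (IsCMField.complexConj L) 3)) : (quasiSplit (↥(maximalRealSubfield L)) L (IsCMField.complexConj L) 3).Adelic) * k) : ℝ)) ^ z₂.re) =
        fun t => ((borelHeight (W * ((heisChart hc (X, traceZeroLine ↥(maximalRealSubfield L) L (IsCMField.complexConj L) hcδ hδ t) :
        ↥(adelicUnipotent ↥(maximalRealSubfield L) L (IsCMField.complexConj L) 3)) : (quasiSplit (↥(maximalRealSubfield L)) L (IsCMField.complexConj L) 3).Adelic)) : ℝ)) ^ z₂.re :=
      funext fun t => by rw [hHk t]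
    calc ∫ t, Cφ * ((borelHeight (W * ((heisChart hc (X, traceZeroLine ↥(maximalRealSubfield L) L (IsCMField.complexConj L) hcδ hδ t) :
          ↥(adelicUnipotent ↥(maximalRealSubfield L) L (IsCMField.complexConj L) 3)) : (quasiSplit (↥(maximalRealSubfield L)) L (IsCMField.complexConj L) 3).Adelic) * k) : ℝ)) ^ z.re ∂μF
        ≤ ∫ t, Cφ * (((borelHeight (W * ((heisChart hc (X, traceZeroLine ↥(maximalRealSubfield L) L (IsCMField.complexConj L) hcδ hδ t) :
          ↥(adelicUnipotent ↥(maximalRealSubfield L) L (IsCMField.complexConj L) 3)) : (quasiSplit (↥(maximalRealSubfield L)) L (IsCMField.complexConj L) 3).Adelic) * k) : ℝ)) ^ z₁.re +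
          ((borelHeight (W * ((heisChart hc (X, traceZeroLine ↥(maximalRealSubfield L) L (IsCMField.complexConj L) hcδ hδ t) :
          ↥(adelicUnipotent ↥(maximalRealSubfield L) L (IsCMField.complexConj L) 3)) : (quasiSplit (↥(maximalRealSubfield L)) L (IsCMField.complexConj L) 3).Adelic) * k) : ℝ)) ^ z₂.re) ∂μF :=
          integral_mono hint ((hi₁.add hi₂).const_mul Cφ) fun t => (Real.le_norm_self _).trans (hdom t)
      _ = Cφ * (∫ t, ((borelHeight (W * ((heisChart hc (X, traceZeroLine ↥(maximalRealSubfield L) L (IsCMField.complexConj L) hcδ hδ t) :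
          ↥(adelicUnipotent ↥(maximalRealSubfield L) L (IsCMField.complexConj L) 3)) : (quasiSplit (↥(maximalRealSubfield L)) L (IsCMField.complexConj L) 3).Adelic) * k) : ℝ)) ^ z₁.re ∂μF +
          ∫ t, ((borelHeight (W * ((heisChart hc (X, traceZeroLine ↥(maximalRealSubfield L) L (IsCMField.complexConj L) hcδ hδ t) :
          ↥(adelicUnipotent ↥(maximalRealSubfield L) L (IsCMField.complexConj L) 3)) : (quasiSplit (↥(maximalRealSubfield L)) L (IsCMField.complexConj L) 3).Adelic) * k) : ℝ)) ^ z₂.re ∂μF) := by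
          rw [integral_const_mul, integral_add hi₁ hi₂]
      _ = _ := by rw [hf₁, hf₂]
  · obtain ⟨hs₁, ht₁⟩ := hS₁ l₁ l₂ Y hl₂ hl
    obtain ⟨hs₂, ht₂⟩ := hS₂ l₁ l₂ Y hl₂ hl
    refine ⟨(hs₁.add hs₂).mul_left Cφ, ?_⟩
    rw [tsum_mul_left, hs₁.tsum_add hs₂]
    calc Cφ * (∑' x₀ : L, ∫ t, ((borelHeight (W * ((heisChart hc ((l₁ : AdeleRing (𝓞 L) L) * (algebraMap L (AdeleRing (𝓞 L) L) x₀ - Y), traceZeroLine ↥(maximalRealSubfield L) L (IsCMField.complexConj L) hcδ hδ t) :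
            ↥(adelicUnipotent ↥(maximalRealSubfield L) L (IsCMField.complexConj L) 3)) : (quasiSplit (↥(maximalRealSubfield L)) L (IsCMField.complexConj L) 3).Adelic)) : ℝ)) ^ z₁.re ∂μF +
          ∑' x₀ : L, ∫ t, ((borelHeight (W * ((heisChart hc ((l₁ : AdeleRing (𝓞 L) L) * (algebraMap L (AdeleRing (𝓞 L) L) x₀ - Y), traceZeroLine ↥(maximalRealSubfield L) L (IsCMField.complexConj L) hcδ hδ t) :
            ↥(adelicUnipotent ↥(maximalRealSubfield L) L (IsCMField.complexConj L) 3)) : (quasiSplit (↥(maximalRealSubfield L)) L (IsCMField.complexConj L) 3).Adelic)) : ℝ)) ^ z₂.re ∂μF)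
        ≤ Cφ * (B₁ * (((IdeleClassGroup.ideleNorm ↥(maximalRealSubfield L) l₂ : ℝ≥0) : ℝ)⁻¹) ^ (2 * ((2 + z₁.re) / 2) - 1) +
            B₂ * (((IdeleClassGroup.ideleNorm ↥(maximalRealSubfield L) l₂ : ℝ≥0) : ℝ)⁻¹) ^ (2 * ((2 + z₁.re) / 2) - 1)) := mul_le_mul_of_nonneg_left (add_le_add ht₁ ht₂) hCφ
      _ = Cφ * (B₁ + B₂) * (((IdeleClassGroup.ideleNorm ↥(maximalRealSubfield L) l₂ : ℝ≥0) : ℝ)⁻¹) ^ (2 * ((2 + z₁.re) / 2) - 1) := by ring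

end Summit.HodgeConjecture.HodgeConjecture.Cruxes.H413.K2E1CentreLineMassUniformCMThree

end
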